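import Summits.ValiantsHypothesis.ValiantsHypothesis.Theorems.SymPencilSingFiveLeafWcolTools

/-!
# Route `SymPencil` — the V-side of the size-27 cell `(11, 5, 4)`, PORT of val-idea-18's cascade, leaf E (part 2: normal position)
# (`--supports` stmt-ValiantsHypothesis-5674 `SdcSuperquadratic`; port of §2b of
# `Cruxes/SdcSuperquadratic/Lines/sing_five_classification.lean` rev 10 (val-idea-18 g5); PORT-PLAN-115.md; rung currency only)

`wcolFive01`: leaf E in normal position `W_col(0,1;3)` (rows `2, 3` dead, column `3` dead) — a `5`-dimensional such `W`
with a per-POINT family of four squares is the hyperplane `{Σ_j θ_j x_(i,j) = 0}` (`i ∈ {0,1}`, `θ₃ = 0`, `θ ≠ 0`).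

Honest framing: [folklore] a verbatim port (the elementary matrices `cellE p` spelled `Pi.single p 1`); `27 ≤ sdc(per₄) ≤ 29`
unchanged; the crux `SdcSuperquadratic` and `VP ≠ VNP` untouched; no summit statement is proved here.  No definitions, no named facts.
-/

noncomputable section

-- single-conjunct layout: Sub = Summit, duplicated namespace component intended
set_option linter.dupNamespace false

namespace Summit.ValiantsHypothesis.ValiantsHypothesis.Theorems.SymPencilSingFiveClassification

open MvPolynomial Module Matrix
open scoped Polynomial
open Literature.Computability.AlgebraicComplexity
open Summit.ValiantsHypothesis.ValiantsHypothesis.Theorems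
open Summit.ValiantsHypothesis.ValiantsHypothesis.Theorems.SymPencilSingSixClassification
open Summit.ValiantsHypothesis.ValiantsHypothesis.Theorems.SymPencilPerFourJointFamilyTransport

variable {K : Type*} [Field K]

/-- **Leaf E in normal position** (`W_col(0,1;3)`: rows `2,3` dead, column `3` dead): a
`5`-dimensional `W ⊆ W_col(0,1;3)` with a per-POINT family of four squares is a torus … (memo). [folklore] -/
theorem wcolFive01 [CharZero K] (W : Submodule K (Fin 4 × Fin 4 → K)) (h5 : finrank K W = 5)
    (hWc : ∀ x ∈ W, (∀ j, x (2, j) = 0) ∧ (∀ j, x (3, j) = 0) ∧ x (0, 3) = 0 ∧ x (1, 3) = 0)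
    (hP : ∀ u : Fin 4 × Fin 4 → K, ∃ (c : Fin 4 → K) (Λ : Fin 4 → ((Fin 4 × Fin 4 → K) →ₗ[K] K)),
      ∀ y ∈ W, ∃ e₀ e₁ : K, ∀ s : K,
        eval (u + s • y) (perPoly (Fin 4) K) = e₀ + s * e₁ + s ^ 2 * ∑ k, c k * (Λ k y) ^ 2) :
    ∃ (i : Fin 4) (θ : Fin 4 → K), (i = 0 ∨ i = 1) ∧ θ 3 = 0 ∧ θ ≠ 0 ∧
      ∀ x : Fin 4 × Fin 4 → K, x ∈ W ↔
        ((∀ j, x (2, j) = 0) ∧ (∀ j, x (3, j) = 0) ∧ x (0, 3) = 0 ∧ x (1, 3) = 0 ∧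
          ∑ j, θ j * x (i, j) = 0) := by
  classical
  obtain ⟨f01, f02, f03, f10, f12, f13, f20, f21, f23, f30, f31, f32⟩ :
      (((0 : Fin 4) = 1) = False) ∧ (((0 : Fin 4) = 2) = False) ∧ (((0 : Fin 4) = 3) = False) ∧
      (((1 : Fin 4) = 0) = False) ∧ (((1 : Fin 4) = 2) = False) ∧ (((1 : Fin 4) = 3) = False) ∧
      (((2 : Fin 4) = 0) = False) ∧ (((2 : Fin 4) = 1) = False) ∧ (((2 : Fin 4) = 3) = False) ∧
      (((3 : Fin 4) = 0) = False) ∧ (((3 : Fin 4) = 1) = False) ∧ (((3 : Fin 4) = 2) = False) := by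
    refine ⟨?_, ?_, ?_, ?_, ?_, ?_, ?_, ?_, ?_, ?_, ?_, ?_⟩ <;> decide
  have hLcard : (Finset.univ.filter fun p : Fin 4 × Fin 4 => (p.1 = 0 ∨ p.1 = 1) ∧ p.2 ≠ 3).card
      = 6 := by decide
  have hLcases : ∀ p ∈ (Finset.univ.filter fun p : Fin 4 × Fin 4 => (p.1 = 0 ∨ p.1 = 1) ∧ p.2 ≠ 3),
      p = (0, 0) ∨ p = (0, 1) ∨ p = (0, 2) ∨ p = (1, 0) ∨ p = (1, 1) ∨ p = (1, 2) := by decide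
  have hLin : ((0, 0) : Fin 4 × Fin 4) ∈ (Finset.univ.filter fun p : Fin 4 × Fin 4 =>
      (p.1 = 0 ∨ p.1 = 1) ∧ p.2 ≠ 3) ∧ ((0, 1) : Fin 4 × Fin 4) ∈ (Finset.univ.filter fun p :
      Fin 4 × Fin 4 => (p.1 = 0 ∨ p.1 = 1) ∧ p.2 ≠ 3) ∧ ((0, 2) : Fin 4 × Fin 4) ∈
      (Finset.univ.filter fun p : Fin 4 × Fin 4 => (p.1 = 0 ∨ p.1 = 1) ∧ p.2 ≠ 3) ∧
      ((1, 0) : Fin 4 × Fin 4) ∈ (Finset.univ.filter fun p : Fin 4 × Fin 4 =>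
      (p.1 = 0 ∨ p.1 = 1) ∧ p.2 ≠ 3) ∧ ((1, 1) : Fin 4 × Fin 4) ∈ (Finset.univ.filter fun p :
      Fin 4 × Fin 4 => (p.1 = 0 ∨ p.1 = 1) ∧ p.2 ≠ 3) ∧ ((1, 2) : Fin 4 × Fin 4) ∈
      (Finset.univ.filter fun p : Fin 4 × Fin 4 => (p.1 = 0 ∨ p.1 = 1) ∧ p.2 ≠ 3) := by decide
  obtain ⟨hL00, hL01, hL02, hL10, hL11, hL12⟩ := hLin
  set L : Finset (Fin 4 × Fin 4) :=
    Finset.univ.filter fun p : Fin 4 × Fin 4 => (p.1 = 0 ∨ p.1 = 1) ∧ p.2 ≠ 3 with hL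
  have live_off : ∀ x : Fin 4 × Fin 4 → K, ((∀ j, x (2, j) = 0) ∧ (∀ j, x (3, j) = 0) ∧
      x (0, 3) = 0 ∧ x (1, 3) = 0) → ∀ p, p ∉ L → x p = 0 := by
    rintro x ⟨h2, h3, h03, h13⟩ ⟨i, j⟩ hp
    have hp' : ¬ ((i = 0 ∨ i = 1) ∧ j ≠ 3) := fun h =>
      hp (Finset.mem_filter.2 ⟨Finset.mem_univ _, h⟩)
    rcases (by decide : ∀ i : Fin 4, i = 0 ∨ i = 1 ∨ i = 2 ∨ i = 3) i with rfl | rfl | rfl | rfl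
    · have hj : j = 3 := by
        by_contra hj
        exact hp' ⟨Or.inl rfl, hj⟩
      rw [hj]; exact h03
    · have hj : j = 3 := by
        by_contra hj
        exact hp' ⟨Or.inr rfl, hj⟩
      rw [hj]; exact h13
    · exact h2 j
    · exact h3 j
  have hcell : ∀ p ∈ L, ∀ q, q ∉ L → (Pi.single p (1 : K) : Fin 4 × Fin 4 → K) q = 0 := by
    intro p hp q hq
    rw [cellE_apply, if_neg]
    rintro rfl
    exact hq hp
  let C6 : Submodule K (Fin 4 × Fin 4 → K) :=
    Submodule.span K (Set.range fun e : ↥L => (Pi.single (e : Fin 4 × Fin 4) (1 : K) : Fin 4 × Fin 4 → K))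
  have hC6mem : ∀ x : Fin 4 × Fin 4 → K, (∀ p, p ∉ L → x p = 0) → x ∈ C6 := by
    intro x hx
    have hdecomp : x = ∑ p ∈ L, x p • (Pi.single p (1 : K) : Fin 4 × Fin 4 → K) :=
      calc x = ∑ p, (Pi.single p (x p) : Fin 4 × Fin 4 → K) := (Finset.univ_sum_single x).symm
        _ = ∑ p ∈ L, (Pi.single p (x p) : Fin 4 × Fin 4 → K) := by
          symm
          refine Finset.sum_subset (Finset.subset_univ L) fun p _ hp => ?_
          rw [hx p hp, Pi.single_zero]
        _ = ∑ p ∈ L, x p • (Pi.single p (1 : K) : Fin 4 × Fin 4 → K) :=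
          Finset.sum_congr rfl fun p _ => by
            ext q
            by_cases hq : q = p
            · subst hq; simp
            · simp [hq]
    rw [hdecomp]
    exact Submodule.sum_mem _ fun p hp =>
      Submodule.smul_mem _ _ (Submodule.subset_span ⟨⟨p, hp⟩, rfl⟩)
  have hli : LinearIndependent K (fun e : ↥L => (Pi.single (e : Fin 4 × Fin 4) (1 : K) : Fin 4 × Fin 4 → K)) := by
    have h := (Pi.basisFun K (Fin 4 × Fin 4)).linearIndependent
    have h' : LinearIndependent K (fun p : Fin 4 × Fin 4 => (Pi.single p (1 : K) : Fin 4 × Fin 4 → K)) := by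
      convert h using 1
      ext p q
      simp [Pi.basisFun_apply]
    exact h'.comp _ Subtype.val_injective
  have hC6rank : finrank K C6 = 6 := by
    rw [finrank_span_eq_card hli, Fintype.card_coe, hLcard]
  have hWC6 : W ≤ C6 := fun x hx => hC6mem x (live_off x (hWc x hx))
  obtain ⟨e, heL, heW⟩ : ∃ e ∈ L, (Pi.single e (1 : K) : Fin 4 × Fin 4 → K) ∉ W := by
    by_contra hall
    push Not at hall
    have hle : C6 ≤ W := Submodule.span_le.2 (by
      rintro _ ⟨e', rfl⟩
      exact hall e' e'.2)
    have h1 := Submodule.finrank_mono hle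
    rw [hC6rank, h5] at h1
    omega
  obtain ⟨φ, hφe, hφW⟩ := Submodule.exists_dual_map_eq_bot_of_notMem heW inferInstance
  have hφ0 : ∀ x ∈ W, φ x = 0 := fun x hx => by
    have h := Submodule.mem_map_of_mem (f := φ) hx
    rw [hφW, Submodule.mem_bot] at h
    exact h
  have hWmem : ∀ x : Fin 4 × Fin 4 → K, (∀ p, p ∉ L → x p = 0) → φ x = 0 → x ∈ W := by
    have hWle : W ≤ C6 ⊓ LinearMap.ker φ :=
      fun x hx => ⟨hWC6 hx, LinearMap.mem_ker.2 (hφ0 x hx)⟩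
    have hlt : C6 ⊓ LinearMap.ker φ < C6 := by
      refine lt_of_le_of_ne inf_le_left fun h => hφe ?_
      have heC : (Pi.single e (1 : K) : Fin 4 × Fin 4 → K) ∈ C6 := Submodule.subset_span ⟨⟨e, heL⟩, rfl⟩
      rw [← h] at heC
      exact LinearMap.mem_ker.1 heC.2
    have hlt' := Submodule.finrank_lt_finrank_of_lt hlt
    have hWeq : W = C6 ⊓ LinearMap.ker φ :=
      Submodule.eq_of_le_of_finrank_le hWle (by rw [hC6rank] at hlt'; omega)
    intro x hx hφx
    rw [hWeq]
    exact ⟨hC6mem x hx, LinearMap.mem_ker.2 hφx⟩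
  have hφx : ∀ x : Fin 4 × Fin 4 → K, ((∀ j, x (2, j) = 0) ∧ (∀ j, x (3, j) = 0) ∧
      x (0, 3) = 0 ∧ x (1, 3) = 0) →
      φ x = x (0, 0) * φ ((Pi.single (0, 0) (1 : K) : Fin 4 × Fin 4 → K)) + x (0, 1) * φ ((Pi.single (0, 1) (1 : K) : Fin 4 × Fin 4 → K)) +
        x (0, 2) * φ ((Pi.single (0, 2) (1 : K) : Fin 4 × Fin 4 → K)) + x (1, 0) * φ ((Pi.single (1, 0) (1 : K) : Fin 4 × Fin 4 → K)) +
        x (1, 1) * φ ((Pi.single (1, 1) (1 : K) : Fin 4 × Fin 4 → K)) + x (1, 2) * φ ((Pi.single (1, 2) (1 : K) : Fin 4 × Fin 4 → K)) := by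
    rintro x ⟨h2, h3, h03, h13⟩
    have hd := live_decomp x h2 h3 h03 h13
    conv_lhs => rw [hd]
    simp only [map_add, map_smul, smul_eq_mul]
  have hF : ∀ ν₀ ν₁ ν₂ : K, ν₀ * ν₁ * ν₂ ≠ 0 →
      -(ν₀ ^ 2 * (φ ((Pi.single (0, 0) (1 : K) : Fin 4 × Fin 4 → K)) * φ ((Pi.single (1, 0) (1 : K) : Fin 4 × Fin 4 → K)))) -
        ν₁ ^ 2 * (φ ((Pi.single (0, 1) (1 : K) : Fin 4 × Fin 4 → K)) * φ ((Pi.single (1, 1) (1 : K) : Fin 4 × Fin 4 → K))) -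
        ν₂ ^ 2 * (φ ((Pi.single (0, 2) (1 : K) : Fin 4 × Fin 4 → K)) * φ ((Pi.single (1, 2) (1 : K) : Fin 4 × Fin 4 → K))) +
        ν₀ * ν₁ * (φ ((Pi.single (0, 0) (1 : K) : Fin 4 × Fin 4 → K)) * φ ((Pi.single (1, 1) (1 : K) : Fin 4 × Fin 4 → K)) + φ ((Pi.single (0, 1) (1 : K) : Fin 4 × Fin 4 → K)) * φ ((Pi.single (1, 0) (1 : K) : Fin 4 × Fin 4 → K))) +
        ν₀ * ν₂ * (φ ((Pi.single (0, 0) (1 : K) : Fin 4 × Fin 4 → K)) * φ ((Pi.single (1, 2) (1 : K) : Fin 4 × Fin 4 → K)) + φ ((Pi.single (0, 2) (1 : K) : Fin 4 × Fin 4 → K)) * φ ((Pi.single (1, 0) (1 : K) : Fin 4 × Fin 4 → K))) +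
        ν₁ * ν₂ * (φ ((Pi.single (0, 1) (1 : K) : Fin 4 × Fin 4 → K)) * φ ((Pi.single (1, 2) (1 : K) : Fin 4 × Fin 4 → K)) + φ ((Pi.single (0, 2) (1 : K) : Fin 4 × Fin 4 → K)) * φ ((Pi.single (1, 1) (1 : K) : Fin 4 × Fin 4 → K)))
        = 0 := by
    intro ν₀ ν₁ ν₂ hν
    have hν' : ν₂ * ν₁ * ν₀ ≠ 0 := by
      intro h; apply hν; linear_combination h
    obtain ⟨u, hu⟩ : ∃ u : Fin 4 × Fin 4 → K, ∀ p, u p = if p = (2, 3) then 1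
        else if p = (3, 0) then ν₀ else if p = (3, 1) then ν₁ else if p = (3, 2) then ν₂ else 0 :=
      ⟨_, fun _ => rfl⟩
    obtain ⟨c, Λ, hfam⟩ := hP u
    obtain ⟨P, hPd⟩ : ∃ P : (Fin 4 × Fin 4 → K) → K, ∀ y, P y =
        ν₀ * (y (0, 1) * y (1, 2) + y (0, 2) * y (1, 1)) +
          ν₁ * (y (0, 0) * y (1, 2) + y (0, 2) * y (1, 0)) +
          ν₂ * (y (0, 0) * y (1, 1) + y (0, 1) * y (1, 0)) := ⟨_, fun _ => rfl⟩
    have hPP : ∀ y ∈ W, ∑ k, c k * (Λ k y) ^ 2 = P y := by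
      intro y hy
      obtain ⟨e₀, e₁, he⟩ := hfam y hy
      obtain ⟨hy2, hy3, hy03, hy13⟩ := hWc y hy
      have hA := eval_wcol_point y hy2 hy3 hy03 hy13 ν₀ ν₁ ν₂ u hu
      rw [hPd]
      exact SymPencilPerFourCrossPairNoJoint.coeff_two_eq_of_forall₂
        (fun s => (he s).symm.trans (hA s))
    let M : ↥W →ₗ[K] (Fin 4 → K) := LinearMap.pi fun k => (Λ k).comp W.subtype
    have hMk : ∀ (w : ↥W) (k : Fin 4), M w k = Λ k (w : Fin 4 × Fin 4 → K) := fun w k => rfl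
    have hker : LinearMap.ker M ≠ ⊥ := LinearMap.ker_ne_bot_of_finrank_lt (by
      rw [Module.finrank_fintype_fun_eq_card, Fintype.card_fin, h5]; norm_num)
    obtain ⟨zW, hzK, hz0⟩ := Submodule.exists_mem_ne_zero_of_ne_bot hker
    have hΛz : ∀ k, Λ k (zW : Fin 4 × Fin 4 → K) = 0 := fun k => by
      have h := congr_fun (LinearMap.mem_ker.1 hzK) k
      rwa [hMk] at h
    have hzW : (zW : Fin 4 × Fin 4 → K) ∈ W := zW.2
    set z : Fin 4 × Fin 4 → K := (zW : Fin 4 × Fin 4 → K) with hz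
    have hzne : z ≠ 0 := by
      intro h
      apply hz0
      have h' : (zW : Fin 4 × Fin 4 → K) = 0 := by rw [← hz]; exact h
      exact (Submodule.coe_eq_zero).1 h'
    have hPz : P z = 0 := by
      rw [← hPP z hzW]
      exact Finset.sum_eq_zero fun k _ => by rw [hΛz k]; ring
    have hPadd : ∀ y ∈ W, P (z + y) = P y := by
      intro y hy
      rw [← hPP (z + y) (W.add_mem hzW hy), ← hPP y hy]
      exact Finset.sum_congr rfl fun k _ => by rw [map_add, hΛz k, zero_add]
    have hPz' := hPz
    rw [hPd] at hPz'
    set Bst : K := P (z + (Pi.single e (1 : K) : Fin 4 × Fin 4 → K)) - P z - P ((Pi.single e (1 : K) : Fin 4 × Fin 4 → K)) with hBst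
    have hrel : ∀ y : Fin 4 × Fin 4 → K, (∀ p, p ∉ L → y p = 0) →
        φ ((Pi.single e (1 : K) : Fin 4 × Fin 4 → K)) * (P (z + y) - P z - P y) = φ y * Bst := by
      intro y hy
      have hmem : φ ((Pi.single e (1 : K) : Fin 4 × Fin 4 → K)) • y - φ y • (Pi.single e (1 : K) : Fin 4 × Fin 4 → K) ∈ W := by
        refine hWmem _ (fun p hp => ?_) ?_
        · simp only [Pi.sub_apply, Pi.smul_apply, smul_eq_mul, hy p hp, hcell e heL p hp,
            mul_zero, sub_zero]
        · simp only [map_sub, map_smul, smul_eq_mul]; ring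
      have h := hPadd _ hmem
      simp only [hBst, hPd, Pi.add_apply, Pi.sub_apply, Pi.smul_apply, smul_eq_mul] at h ⊢
      linear_combination h - hPz'
    have r00 := hrel ((Pi.single (0, 0) (1 : K) : Fin 4 × Fin 4 → K)) (hcell _ hL00)
    have r01 := hrel ((Pi.single (0, 1) (1 : K) : Fin 4 × Fin 4 → K)) (hcell _ hL01)
    have r02 := hrel ((Pi.single (0, 2) (1 : K) : Fin 4 × Fin 4 → K)) (hcell _ hL02)
    have r10 := hrel ((Pi.single (1, 0) (1 : K) : Fin 4 × Fin 4 → K)) (hcell _ hL10)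
    have r11 := hrel ((Pi.single (1, 1) (1 : K) : Fin 4 × Fin 4 → K)) (hcell _ hL11)
    have r12 := hrel ((Pi.single (1, 2) (1 : K) : Fin 4 × Fin 4 → K)) (hcell _ hL12)
    simp only [hPd, Pi.add_apply, cellE_apply, Prod.mk.injEq, f01, f02, f10, f12, f20, f21,
      and_true, and_false, if_true, if_false] at r00 r01 r02 r10 r11 r12
    have q00 : φ ((Pi.single e (1 : K) : Fin 4 × Fin 4 → K)) * (ν₂ * z (1, 1) + ν₁ * z (1, 2)) = φ ((Pi.single (0, 0) (1 : K) : Fin 4 × Fin 4 → K)) * Bst := by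
      linear_combination r00
    have q01 : φ ((Pi.single e (1 : K) : Fin 4 × Fin 4 → K)) * (ν₂ * z (1, 0) + ν₀ * z (1, 2)) = φ ((Pi.single (0, 1) (1 : K) : Fin 4 × Fin 4 → K)) * Bst := by
      linear_combination r01
    have q02 : φ ((Pi.single e (1 : K) : Fin 4 × Fin 4 → K)) * (ν₁ * z (1, 0) + ν₀ * z (1, 1)) = φ ((Pi.single (0, 2) (1 : K) : Fin 4 × Fin 4 → K)) * Bst := by
      linear_combination r02
    have q10 : φ ((Pi.single e (1 : K) : Fin 4 × Fin 4 → K)) * (ν₂ * z (0, 1) + ν₁ * z (0, 2)) = φ ((Pi.single (1, 0) (1 : K) : Fin 4 × Fin 4 → K)) * Bst := by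
      linear_combination r10
    have q11 : φ ((Pi.single e (1 : K) : Fin 4 × Fin 4 → K)) * (ν₂ * z (0, 0) + ν₀ * z (0, 2)) = φ ((Pi.single (1, 1) (1 : K) : Fin 4 × Fin 4 → K)) * Bst := by
      linear_combination r11
    have q12 : φ ((Pi.single e (1 : K) : Fin 4 × Fin 4 → K)) * (ν₁ * z (0, 0) + ν₀ * z (0, 1)) = φ ((Pi.single (1, 2) (1 : K) : Fin 4 × Fin 4 → K)) * Bst := by
      linear_combination r12
    have hBne : Bst ≠ 0 := by
      intro hB
      have k0 : ∀ t : K, φ ((Pi.single e (1 : K) : Fin 4 × Fin 4 → K)) * t = 0 → t = 0 := fun t ht =>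
        (mul_eq_zero.1 ht).resolve_left hφe
      have b0 := k0 _ (by rw [q00, hB, mul_zero])
      have b1 := k0 _ (by rw [q01, hB, mul_zero])
      have b2 := k0 _ (by rw [q02, hB, mul_zero])
      have a0 := k0 _ (by rw [q10, hB, mul_zero])
      have a1 := k0 _ (by rw [q11, hB, mul_zero])
      have a2 := k0 _ (by rw [q12, hB, mul_zero])
      obtain ⟨z10, z11, z12⟩ := SymPencilPerFourHessianMinors.eq_zero_of_pairing₃ hν'
        (z₀ := z (1, 0)) (z₁ := z (1, 1)) (z₂ := z (1, 2))
        (by linear_combination b0) (by linear_combination b1) (by linear_combination b2)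
      obtain ⟨z00, z01, z02⟩ := SymPencilPerFourHessianMinors.eq_zero_of_pairing₃ hν'
        (z₀ := z (0, 0)) (z₁ := z (0, 1)) (z₂ := z (0, 2))
        (by linear_combination a0) (by linear_combination a1) (by linear_combination a2)
      obtain ⟨hz2, hz3, hz03, hz13⟩ := hWc z hzW
      apply hzne
      rw [live_decomp z hz2 hz3 hz03 hz13, z00, z01, z02, z10, z11, z12]
      simp
    have sol : ∀ {a t : K}, φ ((Pi.single e (1 : K) : Fin 4 × Fin 4 → K)) * t = a * Bst → a = φ ((Pi.single e (1 : K) : Fin 4 × Fin 4 → K)) / Bst * t := by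
      intro a t h
      rw [div_mul_eq_mul_div, eq_div_iff hBne]
      linear_combination -h
    rw [sol q00, sol q01, sol q02, sol q10, sol q11, sol q12]
    calc _ = (φ ((Pi.single e (1 : K) : Fin 4 × Fin 4 → K)) / Bst) ^ 2 * (2 * ν₀ * ν₁ * ν₂) *
          (ν₀ * (z (0, 1) * z (1, 2) + z (0, 2) * z (1, 1)) +
            ν₁ * (z (0, 0) * z (1, 2) + z (0, 2) * z (1, 0)) +
            ν₂ * (z (0, 0) * z (1, 1) + z (0, 1) * z (1, 0))) := by ring
      _ = 0 := by rw [hPz']; ring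
  obtain ⟨hA0, hA1, hA2, hS01, hS02, hS12⟩ := coeffs_of_adj_identity hF
  have hpure := pureRow_of_symm_prod hA0 hA1 hA2 hS01 hS02 hS12
  have heq := hLcases e heL
  rcases hpure with ⟨h00, h01, h02⟩ | ⟨h10, h11, h12⟩
  · -- `φ₀ = 0`: the equation lives on row `1`
    refine ⟨1, fun j => if j = 3 then 0 else φ ((Pi.single (1, j) (1 : K) : Fin 4 × Fin 4 → K)), Or.inr rfl, by simp, ?_, fun x => ?_⟩
    · intro hθ
      apply hφe
      rcases heq with rfl | rfl | rfl | rfl | rfl | rfl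
      · exact h00
      · exact h01
      · exact h02
      · have h := congr_fun hθ 0
        simpa using h
      · have h := congr_fun hθ 1
        simpa using h
      · have h := congr_fun hθ 2
        simpa using h
    · constructor
      · intro hx
        have hl := hWc x hx
        refine ⟨hl.1, hl.2.1, hl.2.2.1, hl.2.2.2, ?_⟩
        have h := hφ0 x hx
        rw [hφx x hl, h00, h01, h02] at h
        simp only [Fin.sum_univ_four, Fin.isValue, f03, f13, f23, if_true, if_false, zero_mul,
          add_zero]
        linear_combination h
      · rintro ⟨h2, h3, h03, h13, hs⟩
        refine hWmem x (live_off x ⟨h2, h3, h03, h13⟩) ?_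
        rw [hφx x ⟨h2, h3, h03, h13⟩, h00, h01, h02]
        simp only [Fin.sum_univ_four, Fin.isValue, f03, f13, f23, if_true, if_false, zero_mul,
          add_zero] at hs
        linear_combination hs
  · -- `φ₁ = 0`: the equation lives on row `0`
    refine ⟨0, fun j => if j = 3 then 0 else φ ((Pi.single (0, j) (1 : K) : Fin 4 × Fin 4 → K)), Or.inl rfl, by simp, ?_, fun x => ?_⟩
    · intro hθ
      apply hφe
      rcases heq with rfl | rfl | rfl | rfl | rfl | rfl
      · have h := congr_fun hθ 0
        simpa using h
      · have h := congr_fun hθ 1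
        simpa using h
      · have h := congr_fun hθ 2
        simpa using h
      · exact h10
      · exact h11
      · exact h12
    · constructor
      · intro hx
        have hl := hWc x hx
        refine ⟨hl.1, hl.2.1, hl.2.2.1, hl.2.2.2, ?_⟩
        have h := hφ0 x hx
        rw [hφx x hl, h10, h11, h12] at h
        simp only [Fin.sum_univ_four, Fin.isValue, f03, f13, f23, if_true, if_false, zero_mul,
          add_zero]
        linear_combination h
      · rintro ⟨h2, h3, h03, h13, hs⟩
        refine hWmem x (live_off x ⟨h2, h3, h03, h13⟩) ?_
        rw [hφx x ⟨h2, h3, h03, h13⟩, h10, h11, h12]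
        simp only [Fin.sum_univ_four, Fin.isValue, f03, f13, f23, if_true, if_false, zero_mul,
          add_zero] at hs
        linear_combination hs

end Summit.ValiantsHypothesis.ValiantsHypothesis.Theorems.SymPencilSingFiveClassification
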